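import Summits.Ventures.Crystal3D.Theorems.StickyWulffConstantCoaxialWallLawTwoLatticeTwinPlates
import HarnessLib

/-!
# Readings in a two-lattice configuration IIb: the TRANSLATION plate system forces a fault relation
# (crux `CoaxialWallLaw`, stmt-Ventures-19481, line `WallLedgerF`; interpretation completeness, part 2b)

HONEST FRAMING. Venture `Summits/Ventures/Crystal3D` (cell `crystal3d-full`), helper `--supports` the crux
`CoaxialWallLaw` of `route-Ventures-StickyWulffConstant` (REGISTERED line `WallLedgerF`).  Rung credit; F-C1 not
moved; no census, no kissing facts, pure lattice geometry (19481-p2 g7, cf-p1 g28 §86(79)/(86) item (3)), continuing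
`…TwoLatticeTwinPlates`.

TRANSLATION PLATES (`Λᵢ = L·Λ₀ + sᵢ`, the frame family of `EndRowTrans`):
* **`twin_reading_transPlates`** — a TWIN `(G, m)` reading at a ball of `X ⊆ Λ₁ ∪ Λ₂` forces the FAULT RELATION
  `L⁻¹(s₂ − s₁ − a√(2/3)m) ∈ Λ₀` with `a = ±2`, and `G` or `M_m∘G` has `L`'s slot dozen;
* **`no_twin_reading_transPlates_of_deep`** — hence NO twin reading at all when `L⁻¹(3(s₂ − s₁)) ∉ Λ₀` (the DEEP pairs
  of R3: on-site fillings of a deep translation wall are read by FULL moves only);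
* **`twin_reading_transPlates_normal`** — for a coherent fault `s₂ − s₁ ≡ a'√(2/3)n (mod L·Λ₀)` with `L⁻¹(s₂ − s₁) ∉ Λ₀`
  the reading normal is the fault normal: `m = ±n` (`‖a'√(2/3)n − a√(2/3)m‖² = (2/9)(3a'² + 3a² ∓ 2aa')` is an integer
  only if `3 ∣ a'`).
WHAT THIS IS NOT: not the row, not the certificate; F-C1 not moved.
-/

noncomputable section

namespace Summit.Ventures.Crystal3D.Theorems

open Summit.Ventures.Crystal3D Finset
open Literature.MathematicalPhysics.StatisticalMechanics (fccStacking)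
open scoped InnerProductSpace

/-! ### The translation plate system -/

section TransPlates

variable (L : EuclideanSpace ℝ (Fin 3) ≃ₗᵢ[ℝ] EuclideanSpace ℝ (Fin 3)) {X : Finset (EuclideanSpace ℝ (Fin 3))}

/-- **TWIN readings in the translation plate system force a FAULT RELATION** `L⁻¹(s₂ − s₁ − a√(2/3)m) ∈ Λ₀`,
`a = ±2`, and `G` or `M_m∘G` has `L`'s slots.  See the module docstring. -/
theorem twin_reading_transPlates (s₁ s₂ : EuclideanSpace ℝ (Fin 3))
    (hX : ∀ x ∈ X, x ∈ (fun p => L p + s₁) '' fccStacking 1 (Real.sqrt (2 / 3)) ∨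
      x ∈ (fun p => L p + s₂) '' fccStacking 1 (Real.sqrt (2 / 3)))
    (G : EuclideanSpace ℝ (Fin 3) ≃ₗᵢ[ℝ] EuclideanSpace ℝ (Fin 3)) {m : EuclideanSpace ℝ (Fin 3)} (hm : ‖m‖ = 1)
    (hmenu : ∀ w ∈ fccSlots, ⟪G w, m⟫_ℝ = 0 ∨ ⟪G w, m⟫_ℝ = Real.sqrt (2 / 3) ∨ ⟪G w, m⟫_ℝ = -Real.sqrt (2 / 3))
    {q : EuclideanSpace ℝ (Fin 3)} (hq : q ∈ X)
    (hown : ∀ w ∈ fccSlots, ⟪G w, m⟫_ℝ < 0 → q + G w ∈ X)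
    (hmir : ∀ w ∈ fccSlots, ⟪G w, m⟫_ℝ < 0 → q + (G w - (2 * ⟪G w, m⟫_ℝ) • m) ∈ X) :
    (∃ a : ℤ, (a = 2 ∨ a = -2) ∧ L.symm (s₂ - s₁ - (a : ℝ) • (Real.sqrt (2 / 3) • m)) ∈ fccStacking 1 (Real.sqrt (2 / 3))) ∧
    ((G : EuclideanSpace ℝ (Fin 3) → EuclideanSpace ℝ (Fin 3)) '' ↑fccSlots =
        (L : EuclideanSpace ℝ (Fin 3) → EuclideanSpace ℝ (Fin 3)) '' ↑fccSlots ∨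
      ((G.trans (ℝ ∙ m)ᗮ.reflection : EuclideanSpace ℝ (Fin 3) ≃ₗᵢ[ℝ] EuclideanSpace ℝ (Fin 3)) :
          EuclideanSpace ℝ (Fin 3) → EuclideanSpace ℝ (Fin 3)) '' ↑fccSlots =
        (L : EuclideanSpace ℝ (Fin 3) → EuclideanSpace ℝ (Fin 3)) '' ↑fccSlots) := by
  have hr : 0 < Real.sqrt (2 / 3) := Real.sqrt_pos.2 (by norm_num)
  have hneg : ∀ {w : EuclideanSpace ℝ (Fin 3)}, w ∈ fccSlots → ⟪G w, m⟫_ℝ < 0 → ⟪G w, m⟫_ℝ = -Real.sqrt (2 / 3) := by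
    intro w hw hlt
    rcases hmenu w hw with h | h | h
    · linarith
    · linarith
    · exact h
  -- one lower slot
  have hmenu' : ∀ v ∈ fccSlots, ⟪G v, -m⟫_ℝ = 0 ∨ ⟪G v, -m⟫_ℝ = Real.sqrt (2 / 3) ∨ ⟪G v, -m⟫_ℝ = -Real.sqrt (2 / 3) := by
    intro v hv
    rcases hmenu v hv with h | h | h
    · left; rw [inner_neg_right, h, neg_zero]
    · right; right; rw [inner_neg_right, h]
    · right; left; rw [inner_neg_right, h, neg_neg]
  obtain ⟨l₁, hl₁, -, -, -, -, -, -, -, hn₁, -, -⟩ := exists_three_far_slots G (by rw [norm_neg, hm]) hmenu'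
  have hlt₁ : ⟪G l₁, m⟫_ℝ < 0 := by rw [inner_neg_right] at hn₁; linarith
  -- difference of normalised positions across the two cosets
  have cross : ∀ {s s' x y : EuclideanSpace ℝ (Fin 3)}, x ∈ (fun p => L p + s) '' fccStacking 1 (Real.sqrt (2 / 3)) →
      y ∈ (fun p => L p + s') '' fccStacking 1 (Real.sqrt (2 / 3)) →
      L.symm ((x - s) - (y - s')) ∈ fccStacking 1 (Real.sqrt (2 / 3)) := by
    intro s s' x y hx hy
    rw [mem_movedFcc_iff] at hx hy
    rw [map_sub]; exact fcc_sub_site_mem hx hy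
  have hmir₁ : q + (G l₁ - (2 * ⟪G l₁, m⟫_ℝ) • m) = q + G l₁ + (2 : ℝ) • (Real.sqrt (2 / 3) • m) := by
    rw [hneg hl₁ hlt₁]; module
  rcases hX q hq with hq₁ | hq₂
  · rcases twin_reading_twoLattice L L s₁ s₂ hX G hm hmenu hq₁ hown hmir with ⟨hfr, hs⟩ | ⟨hfr, hs⟩
    · obtain ⟨hd, -, hu, -⟩ := hs l₁ hl₁ hlt₁
      rw [hmir₁] at hu
      refine ⟨⟨2, Or.inl rfl, ?_⟩, Or.inl hfr⟩
      have h := cross hu hd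
      have e : s₂ - s₁ - ((2 : ℤ) : ℝ) • (Real.sqrt (2 / 3) • m) =
          -((q + G l₁ + (2 : ℝ) • (Real.sqrt (2 / 3) • m) - s₂) - (q + G l₁ - s₁)) := by push_cast; module
      rw [e, map_neg]; exact fcc_neg_mem h
    · obtain ⟨hd, -, hu, -⟩ := hs l₁ hl₁ hlt₁
      rw [hmir₁] at hu
      refine ⟨⟨-2, Or.inr rfl, ?_⟩, Or.inr hfr⟩
      have h := cross hd hu
      have e : s₂ - s₁ - ((-2 : ℤ) : ℝ) • (Real.sqrt (2 / 3) • m) =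
          -((q + G l₁ - s₂) - (q + G l₁ + (2 : ℝ) • (Real.sqrt (2 / 3) • m) - s₁)) := by push_cast; module
      rw [e, map_neg]; exact fcc_neg_mem h
  · have hX' : ∀ x ∈ X, x ∈ (fun p => L p + s₂) '' fccStacking 1 (Real.sqrt (2 / 3)) ∨
        x ∈ (fun p => L p + s₁) '' fccStacking 1 (Real.sqrt (2 / 3)) := fun x hx => (hX x hx).symm
    rcases twin_reading_twoLattice L L s₂ s₁ hX' G hm hmenu hq₂ hown hmir with ⟨hfr, hs⟩ | ⟨hfr, hs⟩
    · obtain ⟨hd, -, hu, -⟩ := hs l₁ hl₁ hlt₁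
      rw [hmir₁] at hu
      refine ⟨⟨-2, Or.inr rfl, ?_⟩, Or.inl hfr⟩
      have h := cross hu hd
      have e : s₂ - s₁ - ((-2 : ℤ) : ℝ) • (Real.sqrt (2 / 3) • m) =
          (q + G l₁ + (2 : ℝ) • (Real.sqrt (2 / 3) • m) - s₁) - (q + G l₁ - s₂) := by push_cast; module
      rw [e]; exact h
    · obtain ⟨hd, -, hu, -⟩ := hs l₁ hl₁ hlt₁
      rw [hmir₁] at hu
      refine ⟨⟨2, Or.inl rfl, ?_⟩, Or.inr hfr⟩
      have h := cross hd hu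
      have e : s₂ - s₁ - ((2 : ℤ) : ℝ) • (Real.sqrt (2 / 3) • m) =
          (q + G l₁ - s₁) - (q + G l₁ + (2 : ℝ) • (Real.sqrt (2 / 3) • m) - s₂) := by push_cast; module
      rw [e]; exact h

/-- **No twin reading for DEEP translation pairs**: if `L⁻¹(3(s₂ − s₁)) ∉ Λ₀` then no frame reads a twin dozen on
`X ⊆ (L·Λ₀ + s₁) ∪ (L·Λ₀ + s₂)`. -/
theorem no_twin_reading_transPlates_of_deep (s₁ s₂ : EuclideanSpace ℝ (Fin 3))
    (hdeep : L.symm ((3 : ℝ) • (s₂ - s₁)) ∉ fccStacking 1 (Real.sqrt (2 / 3)))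
    (hX : ∀ x ∈ X, x ∈ (fun p => L p + s₁) '' fccStacking 1 (Real.sqrt (2 / 3)) ∨
      x ∈ (fun p => L p + s₂) '' fccStacking 1 (Real.sqrt (2 / 3)))
    (G : EuclideanSpace ℝ (Fin 3) ≃ₗᵢ[ℝ] EuclideanSpace ℝ (Fin 3)) {m : EuclideanSpace ℝ (Fin 3)} (hm : ‖m‖ = 1)
    (hmenu : ∀ w ∈ fccSlots, ⟪G w, m⟫_ℝ = 0 ∨ ⟪G w, m⟫_ℝ = Real.sqrt (2 / 3) ∨ ⟪G w, m⟫_ℝ = -Real.sqrt (2 / 3))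
    {q : EuclideanSpace ℝ (Fin 3)} (hq : q ∈ X)
    (hown : ∀ w ∈ fccSlots, ⟪G w, m⟫_ℝ < 0 → q + G w ∈ X)
    (hmir : ∀ w ∈ fccSlots, ⟪G w, m⟫_ℝ < 0 → q + (G w - (2 * ⟪G w, m⟫_ℝ) • m) ∈ X) : False := by
  obtain ⟨⟨a, ha, hrel⟩, hfr⟩ := twin_reading_transPlates L s₁ s₂ hX G hm hmenu hq hown hmir
  -- `m` is a menu normal of `L`
  have hLm : ∀ w ∈ fccSlots, ⟪L w, m⟫_ℝ = 0 ∨ ⟪L w, m⟫_ℝ = Real.sqrt (2 / 3) ∨ ⟪L w, m⟫_ℝ = -Real.sqrt (2 / 3) := by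
    rcases hfr with hfr | hfr
    · exact menu_of_image_fccSlots_eq hfr.symm hmenu
    · refine menu_of_image_fccSlots_eq hfr.symm ?_
      intro w hw
      rw [LinearIsometryEquiv.trans_apply, reflection_unit_apply hm, inner_sub_left, real_inner_smul_left,
        real_inner_self_eq_norm_sq, hm]
      rcases hmenu w hw with h | h | h
      · left; rw [h]; ring
      · right; right; rw [h]; ring
      · right; left; rw [h]; ring
  have h3m := symm_sqrt6_menu_mem L hLm
  apply hdeep
  have e : (3 : ℝ) • (s₂ - s₁) = ((3 : ℤ) : ℝ) • (s₂ - s₁ - (a : ℝ) • (Real.sqrt (2 / 3) • m)) +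
      (a : ℝ) • ((3 : ℝ) • (Real.sqrt (2 / 3) • m)) := by push_cast; module
  rw [e]
  exact symm_mem_fcc_add L (symm_mem_fcc_zsmul L 3 hrel) (symm_mem_fcc_zsmul L a h3m)

/-- **For a coherent FAULT pair the reading normal is the fault normal**: if `L⁻¹(s₂ − s₁ − a'√(2/3)n) ∈ Λ₀` for a unit
menu normal `n` of `L` and `L⁻¹(s₂ − s₁) ∉ Λ₀`, then a twin reading `(G, m)` on `X ⊆ (L·Λ₀+s₁) ∪ (L·Λ₀+s₂)` has `m = ±n`. -/
theorem twin_reading_transPlates_normal (s₁ s₂ : EuclideanSpace ℝ (Fin 3))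
    {n : EuclideanSpace ℝ (Fin 3)} (hn : ‖n‖ = 1)
    (hnmenu : ∀ w ∈ fccSlots, ⟪L w, n⟫_ℝ = 0 ∨ ⟪L w, n⟫_ℝ = Real.sqrt (2 / 3) ∨ ⟪L w, n⟫_ℝ = -Real.sqrt (2 / 3))
    {a' : ℤ} (hfault : L.symm (s₂ - s₁ - (a' : ℝ) • (Real.sqrt (2 / 3) • n)) ∈ fccStacking 1 (Real.sqrt (2 / 3)))
    (hne : L.symm (s₂ - s₁) ∉ fccStacking 1 (Real.sqrt (2 / 3)))
    (hX : ∀ x ∈ X, x ∈ (fun p => L p + s₁) '' fccStacking 1 (Real.sqrt (2 / 3)) ∨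
      x ∈ (fun p => L p + s₂) '' fccStacking 1 (Real.sqrt (2 / 3)))
    (G : EuclideanSpace ℝ (Fin 3) ≃ₗᵢ[ℝ] EuclideanSpace ℝ (Fin 3)) {m : EuclideanSpace ℝ (Fin 3)} (hm : ‖m‖ = 1)
    (hmenu : ∀ w ∈ fccSlots, ⟪G w, m⟫_ℝ = 0 ∨ ⟪G w, m⟫_ℝ = Real.sqrt (2 / 3) ∨ ⟪G w, m⟫_ℝ = -Real.sqrt (2 / 3))
    {q : EuclideanSpace ℝ (Fin 3)} (hq : q ∈ X)
    (hown : ∀ w ∈ fccSlots, ⟪G w, m⟫_ℝ < 0 → q + G w ∈ X)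
    (hmir : ∀ w ∈ fccSlots, ⟪G w, m⟫_ℝ < 0 → q + (G w - (2 * ⟪G w, m⟫_ℝ) • m) ∈ X) : m = n ∨ m = -n := by
  obtain ⟨⟨a, ha, hrel⟩, hfr⟩ := twin_reading_transPlates L s₁ s₂ hX G hm hmenu hq hown hmir
  have hLm : ∀ w ∈ fccSlots, ⟪L w, m⟫_ℝ = 0 ∨ ⟪L w, m⟫_ℝ = Real.sqrt (2 / 3) ∨ ⟪L w, m⟫_ℝ = -Real.sqrt (2 / 3) := by
    rcases hfr with hfr | hfr
    · exact menu_of_image_fccSlots_eq hfr.symm hmenu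
    · refine menu_of_image_fccSlots_eq hfr.symm ?_
      intro w hw
      rw [LinearIsometryEquiv.trans_apply, reflection_unit_apply hm, inner_sub_left, real_inner_smul_left,
        real_inner_self_eq_norm_sq, hm]
      rcases hmenu w hw with h | h | h
      · left; rw [h]; ring
      · right; right; rw [h]; ring
      · right; left; rw [h]; ring
  -- `v = a'√(2/3) n − a√(2/3) m` is an `L`-lattice vector
  have hv : L.symm ((a' : ℝ) • (Real.sqrt (2 / 3) • n) - (a : ℝ) • (Real.sqrt (2 / 3) • m)) ∈
      fccStacking 1 (Real.sqrt (2 / 3)) := by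
    have e : (a' : ℝ) • (Real.sqrt (2 / 3) • n) - (a : ℝ) • (Real.sqrt (2 / 3) • m) =
        (s₂ - s₁ - (a : ℝ) • (Real.sqrt (2 / 3) • m)) - (s₂ - s₁ - (a' : ℝ) • (Real.sqrt (2 / 3) • n)) := by abel
    rw [e, map_sub]; exact fcc_sub_site_mem hrel hfault
  -- `3 ∤ a'` (else `s₂ − s₁` itself would be an `L`-lattice vector)
  have ha' : ¬ (3 : ℤ) ∣ a' := by
    rintro ⟨b, rfl⟩
    apply hne
    have h3n := symm_sqrt6_menu_mem L hnmenu
    have e : s₂ - s₁ = (s₂ - s₁ - ((3 * b : ℤ) : ℝ) • (Real.sqrt (2 / 3) • n)) + (b : ℝ) • ((3 : ℝ) • (Real.sqrt (2 / 3) • n)) := by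
      push_cast; module
    rw [e]
    exact symm_mem_fcc_add L hfault (symm_mem_fcc_zsmul L b h3n)
  -- if `m ≠ ±n` then `⟪n, m⟫ = ±1/3` and `‖v‖² = (2/9)(3a'² + 3a² ∓ 2aa')` is not an integer
  by_contra hmn
  push Not at hmn
  have hi := inner_menuNormals L hn hm hnmenu hLm
  have hthird : ⟪n, m⟫_ℝ = 1 / 3 ∨ ⟪n, m⟫_ℝ = -1 / 3 := by
    rcases hi with h | h | h | h
    · exact absurd ((inner_eq_one_iff_of_norm_eq_one (𝕜 := ℝ) hn hm).1 h).symm hmn.1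
    · exact absurd (eq_neg_of_inner_eq_neg_one' hn hm h) hmn.2
    · exact Or.inl h
    · exact Or.inr h
  obtain ⟨z, hz⟩ := exists_int_norm_sq_of_mem_fcc hv
  rw [LinearIsometryEquiv.norm_map] at hz
  have h23 : Real.sqrt (2 / 3) ^ 2 = 2 / 3 := Real.sq_sqrt (by norm_num)
  have hnn : ⟪n, n⟫_ℝ = 1 := by rw [real_inner_self_eq_norm_sq, hn, one_pow]
  have hmm : ⟪m, m⟫_ℝ = 1 := by rw [real_inner_self_eq_norm_sq, hm, one_pow]
  have hmn : ⟪m, n⟫_ℝ = ⟪n, m⟫_ℝ := real_inner_comm _ _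
  have hexp : ‖(a' : ℝ) • (Real.sqrt (2 / 3) • n) - (a : ℝ) • (Real.sqrt (2 / 3) • m)‖ ^ 2 =
      (2 / 3) * ((a' : ℝ) ^ 2 + (a : ℝ) ^ 2 - 2 * a' * a * ⟪n, m⟫_ℝ) := by
    rw [← real_inner_self_eq_norm_sq]
    simp only [inner_sub_left, inner_sub_right, real_inner_smul_left, real_inner_smul_right, hnn, hmm, hmn]
    linear_combination ((a' : ℝ) ^ 2 + (a : ℝ) ^ 2 - 2 * (a' : ℝ) * (a : ℝ) * ⟪n, m⟫_ℝ) * h23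
  rw [hexp] at hz
  -- integrality: `9 z = 2(3a'² + 3a² ∓ 2 a' a)`, so `3 ∣ 2 a' a`, so `3 ∣ a'` (as `a = ±2`)
  rcases hthird with h | h
  · rw [h] at hz
    have hint : (9 * z : ℤ) = 6 * a' ^ 2 + 6 * a ^ 2 - 4 * a' * a := by
      have : ((9 * z : ℤ) : ℝ) = ((6 * a' ^ 2 + 6 * a ^ 2 - 4 * a' * a : ℤ) : ℝ) := by push_cast; linarith
      exact_mod_cast this
    apply ha'
    rcases ha with rfl | rfl <;> omega
  · rw [h] at hz
    have hint : (9 * z : ℤ) = 6 * a' ^ 2 + 6 * a ^ 2 + 4 * a' * a := by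
      have : ((9 * z : ℤ) : ℝ) = ((6 * a' ^ 2 + 6 * a ^ 2 + 4 * a' * a : ℤ) : ℝ) := by push_cast; linarith
      exact_mod_cast this
    apply ha'
    rcases ha with rfl | rfl <;> omega

end TransPlates

end Summit.Ventures.Crystal3D.Theorems

end
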